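import Mathlib
import Summits.CriticalPhenomena.Ising3DConformalLimit.Theses.HarmonicMomentsIsotropy
import Summits.CriticalPhenomena.Ising3DConformalLimit.Theorems.HarmonicMomentsIsotropyHarmonicDilution
import Summits.CriticalPhenomena.Ising3DConformalLimit.Theorems.HarmonicMomentsIsotropyHarmonicDilutionSymmetric
import Literature.Probability.LatticeModels.MessagerMiracleSoleFree
import HarnessLib

/-!
# Route HarmonicMomentsIsotropy — Reynolds reduction of `HarmonicDilution` to invariant harmonics

Item `stmt-CriticalPhenomena-6034` (`HarmonicDilution`): every anisotropy ratio
`a_{Y,m}(β) = k_{Y,m}(β)/M_{n+2m}(β)`, `k_{Y,m}(β) = ∑_x Y(x)|x|^{2m}⟨σ₀σ_x⟩^∅_β` on `ℤ³`, of a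
harmonic homogeneous `Y` of degree `n ≥ 1` tends to `0` as `β ↑ β_c(3)` (open: the CPRV
prediction).  The symmetric-sector file shows `k_{Y,m} ≡ 0` when the hyperoctahedral
symmetrisation of `Y` vanishes and reduces the item to even `n ≥ 4`.  This file proves the
complementary, sharper reduction (unconditionally):

* `harmonicDilution_iff_invariant`: `HarmonicDilution` is EQUIVALENT to its restriction to the
  harmonic homogeneous `Y` of even degree `n ≥ 4` that are INVARIANT under all `48` signed
  coordinate permutations `g = (π, ε) ∈ B₃ = S₃ ⋉ {±1}³`, `Y(g v) = Y(v)`, `(g v)ᵢ = εᵢ v_{π⁻¹ i}` —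
  i.e. to the cubic harmonics proper (`K₄`; one line each in degrees `6, 8, 10`; …).

Mechanism (the Reynolds operator).  `B₃` acts on `ℝ[X₀,X₁,X₂]` by the algebra maps
`Xᵢ ↦ εᵢ X_{π⁻¹ i}` (`MvPolynomial.aeval`), with `(Y ∘ g)(v) = Y(g v)` (`eval_signedPermAct`);
the action preserves homogeneity (`isHomogeneous_signedPermAct`) and satisfies the chain rule
`∂ᵢ(Y ∘ g) = ε_{πi} (∂_{πi} Y) ∘ g` (`pderiv_signedPermAct`, by induction on `Y`), hence commutes
with the Laplacian (`laplacian_signedPermAct`: `Y ∘ g` is harmonic when `Y` is).  The Reynolds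
polynomial `R Y = ∑_g Y ∘ g` is invariant (`eval_reynolds_signedPerm`, two reindexings of the
wreath product, `signedPermAct_comp`), and below `β_c` its moments are `k_{R Y,m} = 48 k_{Y,m}`
(`harmonicMoment_reynolds`: each transformed moment equals `k_{Y,m}` by the lattice symmetry of
`|x|` and of `⟨σ₀σ_x⟩^∅_β`, `twoPointFree_signedPerm`, and summability below `β_c`,
`summable_polyMoment`).  So `a_{Y,m} = a_{R Y,m}/48` on `(0, β_c)` and the invariant case implies
the general one.

Also here (used by the quartic file): `summable_polyMoment` (summability of
`x ↦ Y(x)|x|^{2m}G_β(x)` for `0 ≤ β < β_c`, from exponential decay) and `card_signedPerm_three`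
(`|B₃| = 48`).
-/

namespace Summit.CriticalPhenomena.Ising3DConformalLimit.Theorems

open Filter Topology Set
open Literature.Probability.LatticeModels
open Summit.CriticalPhenomena.Ising3DConformalLimit.Theses.HarmonicMomentsIsotropy

/-! ### Two utilities: summable polynomial moments, `|B₃| = 48` -/

/-- Summability of `x ↦ Y(x)|x|^{2m}⟨σ₀σ_x⟩^∅_β` for `0 ≤ β < β_c` and homogeneous `Y`. -/
theorem summable_polyMoment {β : ℝ} (hβ : 0 ≤ β) (hβc : β < criticalBeta 3)
    (Y : MvPolynomial (Fin 3) ℝ) {n : ℕ} (hY : Y.IsHomogeneous n) (m : ℕ) :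
    Summable fun x : Site 3 => MvPolynomial.eval (fun i => ((x i : ℤ) : ℝ)) Y *
      Real.sqrt (∑ j, ((x j : ℤ) : ℝ) ^ 2) ^ (2 * m) * twoPointFree 3 β x := by
  set CY : ℝ := ∑ d ∈ Y.support, |Y.coeff d| with hCY
  have hG0 : ∀ x, 0 ≤ twoPointFree 3 β x := fun x => twoPointFree_nonneg_of_nonneg (d := 3) hβ x
  have hgs : Summable fun x : Site 3 =>
      Real.sqrt (∑ j, ((x j : ℤ) : ℝ) ^ 2) ^ (n + 2 * m) * twoPointFree 3 β x :=
    summable_moment hβ hβc (n + 2 * m)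
  refine (hgs.mul_left CY).of_norm_bounded (fun x => ?_)
  have hnE0 : 0 ≤ Real.sqrt (∑ j, ((x j : ℤ) : ℝ) ^ 2) := Real.sqrt_nonneg _
  have hev : |MvPolynomial.eval (fun i => ((x i : ℤ) : ℝ)) Y| ≤
      CY * Real.sqrt (∑ j, ((x j : ℤ) : ℝ) ^ 2) ^ n :=
    abs_eval_le_of_isHomogeneous Y hY _ (fun i => abs_coord_le_euclid x i)
  rw [Real.norm_eq_abs, abs_mul, abs_mul, abs_of_nonneg (hG0 x), abs_of_nonneg (pow_nonneg hnE0 _)]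
  calc |MvPolynomial.eval (fun i => ((x i : ℤ) : ℝ)) Y| *
        Real.sqrt (∑ j, ((x j : ℤ) : ℝ) ^ 2) ^ (2 * m) * twoPointFree 3 β x
      ≤ CY * Real.sqrt (∑ j, ((x j : ℤ) : ℝ) ^ 2) ^ n *
          Real.sqrt (∑ j, ((x j : ℤ) : ℝ) ^ 2) ^ (2 * m) * twoPointFree 3 β x :=
        mul_le_mul_of_nonneg_right (mul_le_mul_of_nonneg_right hev (pow_nonneg hnE0 _)) (hG0 x)
    _ = CY * (Real.sqrt (∑ j, ((x j : ℤ) : ℝ) ^ 2) ^ (n + 2 * m) * twoPointFree 3 β x) := by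
        rw [pow_add]; ring

/-- The hyperoctahedral group `B₃` (signed coordinate permutations) has `48` elements. -/
theorem card_signedPerm_three :
    (Finset.univ : Finset (Equiv.Perm (Fin 3) × (Fin 3 → ℤˣ))).card = 48 := by
  rw [Finset.card_univ, Fintype.card_prod, Fintype.card_perm, Fintype.card_fin]
  simp [Nat.factorial]

/-! ### The hyperoctahedral action on polynomials and the Reynolds reduction -/

/-- Evaluation of the transformed polynomial `Y ∘ g`, `g = (π, ε)` acting by
`Xᵢ ↦ εᵢ X_{π⁻¹ i}`: `(Y ∘ g)(v) = Y(g v)` with `(g v)ᵢ = εᵢ v_{π⁻¹ i}`. -/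
theorem eval_signedPermAct (π : Equiv.Perm (Fin 3)) (ε : Fin 3 → ℤˣ)
    (Y : MvPolynomial (Fin 3) ℝ) (v : Fin 3 → ℝ) :
    MvPolynomial.eval v (MvPolynomial.aeval
      (fun i => MvPolynomial.C ((ε i : ℤ) : ℝ) * MvPolynomial.X (π.symm i)) Y) =
      MvPolynomial.eval (fun i => ((ε i : ℤ) : ℝ) * v (π.symm i)) Y := by
  rw [MvPolynomial.aeval_eq_bind₁]
  show MvPolynomial.eval₂Hom (RingHom.id ℝ) v (MvPolynomial.bind₁ _ Y) = _
  rw [MvPolynomial.eval₂Hom_bind₁]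
  simp

/-- `Y ∘ g` is homogeneous of the same degree as `Y`. -/
theorem isHomogeneous_signedPermAct (π : Equiv.Perm (Fin 3)) (ε : Fin 3 → ℤˣ)
    {Y : MvPolynomial (Fin 3) ℝ} {n : ℕ} (hY : Y.IsHomogeneous n) :
    (MvPolynomial.aeval
      (fun i => MvPolynomial.C ((ε i : ℤ) : ℝ) * MvPolynomial.X (π.symm i)) Y).IsHomogeneous n := by
  have h := hY.aeval (fun i => MvPolynomial.C ((ε i : ℤ) : ℝ) * MvPolynomial.X (π.symm i))
    (fun i => (MvPolynomial.isHomogeneous_X ℝ (π.symm i)).C_mul _)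
  rwa [one_mul] at h

/-- Chain rule for the action: `∂ᵢ (Y ∘ g) = ε_{π i} · (∂_{π i} Y) ∘ g`. -/
theorem pderiv_signedPermAct (π : Equiv.Perm (Fin 3)) (ε : Fin 3 → ℤˣ) (i : Fin 3)
    (Y : MvPolynomial (Fin 3) ℝ) :
    MvPolynomial.pderiv i (MvPolynomial.aeval
      (fun j => MvPolynomial.C ((ε j : ℤ) : ℝ) * MvPolynomial.X (π.symm j)) Y) =
      MvPolynomial.C ((ε (π i) : ℤ) : ℝ) * MvPolynomial.aeval
        (fun j => MvPolynomial.C ((ε j : ℤ) : ℝ) * MvPolynomial.X (π.symm j))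
          (MvPolynomial.pderiv (π i) Y) := by
  induction Y using MvPolynomial.induction_on with
  | C a => simp [MvPolynomial.algebraMap_eq]
  | add p q hp hq => rw [map_add, map_add, hp, hq, map_add, map_add, mul_add]
  | mul_X p j hp =>
    by_cases hj : j = π i
    · subst hj
      simp only [map_mul, MvPolynomial.pderiv_mul, hp, MvPolynomial.aeval_X,
        Equiv.symm_apply_apply, MvPolynomial.pderiv_X_self, MvPolynomial.pderiv_C, zero_mul,
        zero_add, mul_one, map_add]
      ring
    · have h1 : π.symm j ≠ i := fun h => hj (by rw [← h, Equiv.apply_symm_apply])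
      simp only [map_mul, MvPolynomial.pderiv_mul, hp, MvPolynomial.aeval_X,
        MvPolynomial.pderiv_X_of_ne h1, MvPolynomial.pderiv_X_of_ne hj, MvPolynomial.pderiv_C,
        zero_mul, add_zero, mul_zero, mul_assoc]

/-- The action commutes with the Laplacian up to the action: `Δ(Y ∘ g) = (ΔY) ∘ g`; in
particular `Y ∘ g` is harmonic when `Y` is. -/
theorem laplacian_signedPermAct (π : Equiv.Perm (Fin 3)) (ε : Fin 3 → ℤˣ)
    {Y : MvPolynomial (Fin 3) ℝ}
    (hΔ : ∑ i : Fin 3, MvPolynomial.pderiv i (MvPolynomial.pderiv i Y) = 0) :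
    ∑ i : Fin 3, MvPolynomial.pderiv i (MvPolynomial.pderiv i (MvPolynomial.aeval
      (fun j => MvPolynomial.C ((ε j : ℤ) : ℝ) * MvPolynomial.X (π.symm j)) Y)) = 0 := by
  have hsq : ∀ i : Fin 3, (MvPolynomial.C ((ε (π i) : ℤ) : ℝ) : MvPolynomial (Fin 3) ℝ) *
      MvPolynomial.C ((ε (π i) : ℤ) : ℝ) = 1 := by
    intro i
    rw [← MvPolynomial.C_mul, ← Int.cast_mul, ← Units.val_mul, Int.units_mul_self, Units.val_one,
      Int.cast_one, MvPolynomial.C_1]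
  have hterm : ∀ i : Fin 3, MvPolynomial.pderiv i (MvPolynomial.pderiv i (MvPolynomial.aeval
      (fun j => MvPolynomial.C ((ε j : ℤ) : ℝ) * MvPolynomial.X (π.symm j)) Y)) =
      MvPolynomial.aeval (fun j => MvPolynomial.C ((ε j : ℤ) : ℝ) * MvPolynomial.X (π.symm j))
        (MvPolynomial.pderiv (π i) (MvPolynomial.pderiv (π i) Y)) := by
    intro i
    rw [pderiv_signedPermAct, MvPolynomial.pderiv_C_mul, pderiv_signedPermAct, ← mul_assoc, hsq,
      one_mul]
  simp_rw [hterm]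
  rw [← map_sum, Equiv.sum_comp π (fun j => MvPolynomial.pderiv j (MvPolynomial.pderiv j Y)), hΔ,
    map_zero]

/-- Composition of the actions on vectors: acting by `(π, ε)` after `(π', ε')` is acting by
`(π π', ε · (ε' ∘ π⁻¹))`. -/
theorem signedPermAct_comp (π π' : Equiv.Perm (Fin 3)) (ε ε' : Fin 3 → ℤˣ) (v : Fin 3 → ℝ) :
    (fun i => ((ε i : ℤ) : ℝ) * (fun j => ((ε' j : ℤ) : ℝ) * v (π'.symm j)) (π.symm i)) =
      fun i => (((ε * fun j => ε' (π.symm j)) i : ℤ) : ℝ) * v ((π * π').symm i) := by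
  funext i
  simp only [Pi.mul_apply, Units.val_mul, Int.cast_mul, Equiv.Perm.mul_def, Equiv.symm_trans_apply]
  ring

/-- **Invariance of the Reynolds polynomial.**  `R Y = ∑_{g ∈ B₃} Y ∘ g` satisfies
`(R Y)(h v) = (R Y)(v)` for every signed coordinate permutation `h`. -/
theorem eval_reynolds_signedPerm (Y : MvPolynomial (Fin 3) ℝ) (π' : Equiv.Perm (Fin 3))
    (ε' : Fin 3 → ℤˣ) (v : Fin 3 → ℝ) :
    MvPolynomial.eval (fun i => ((ε' i : ℤ) : ℝ) * v (π'.symm i))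
        (∑ g : Equiv.Perm (Fin 3) × (Fin 3 → ℤˣ), MvPolynomial.aeval
          (fun i => MvPolynomial.C ((g.2 i : ℤ) : ℝ) * MvPolynomial.X (g.1.symm i)) Y) =
      MvPolynomial.eval v
        (∑ g : Equiv.Perm (Fin 3) × (Fin 3 → ℤˣ), MvPolynomial.aeval
          (fun i => MvPolynomial.C ((g.2 i : ℤ) : ℝ) * MvPolynomial.X (g.1.symm i)) Y) := by
  rw [map_sum, map_sum]
  simp_rw [eval_signedPermAct]
  rw [Fintype.sum_prod_type, Fintype.sum_prod_type]
  simp only []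
  -- reindex the sign sum for each `π`, then the permutation sum
  have hinner : ∀ π : Equiv.Perm (Fin 3),
      ∑ ε : Fin 3 → ℤˣ, MvPolynomial.eval
          (fun i => ((ε i : ℤ) : ℝ) * (fun j => ((ε' j : ℤ) : ℝ) * v (π'.symm j)) (π.symm i)) Y =
        ∑ ε : Fin 3 → ℤˣ, MvPolynomial.eval (fun i => ((ε i : ℤ) : ℝ) * v ((π * π').symm i)) Y := by
    intro π
    simp_rw [signedPermAct_comp]
    exact Equiv.sum_comp (Equiv.mulRight (fun j => ε' (π.symm j)))
      (fun ε : Fin 3 → ℤˣ => MvPolynomial.eval (fun i => ((ε i : ℤ) : ℝ) * v ((π * π').symm i)) Y)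
  rw [Finset.sum_congr rfl fun π _ => hinner π]
  exact Equiv.sum_comp (Equiv.mulRight π')
    (fun π : Equiv.Perm (Fin 3) => ∑ ε : Fin 3 → ℤˣ,
      MvPolynomial.eval (fun i => ((ε i : ℤ) : ℝ) * v (π.symm i)) Y)

/-- **Moments of the Reynolds polynomial.**  For `0 ≤ β < β_c(3)` and homogeneous `Y`,
`k_{R Y,m}(β) = 48 · k_{Y,m}(β)` (each of the `48` transformed moments equals `k_{Y,m}` by the
lattice symmetry of `|x|` and of `⟨σ₀σ_x⟩^∅_β`). -/
theorem harmonicMoment_reynolds {β : ℝ} (hβ : 0 ≤ β) (hβc : β < criticalBeta 3)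
    (Y : MvPolynomial (Fin 3) ℝ) {n : ℕ} (hY : Y.IsHomogeneous n) (m : ℕ) :
    ∑' x : Site 3, MvPolynomial.eval (fun i => ((x i : ℤ) : ℝ))
        (∑ g : Equiv.Perm (Fin 3) × (Fin 3 → ℤˣ), MvPolynomial.aeval
          (fun i => MvPolynomial.C ((g.2 i : ℤ) : ℝ) * MvPolynomial.X (g.1.symm i)) Y) *
        Real.sqrt (∑ j, ((x j : ℤ) : ℝ) ^ 2) ^ (2 * m) * twoPointFree 3 β x =
      48 * ∑' x : Site 3, MvPolynomial.eval (fun i => ((x i : ℤ) : ℝ)) Y *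
        Real.sqrt (∑ j, ((x j : ℤ) : ℝ) ^ 2) ^ (2 * m) * twoPointFree 3 β x := by
  set nE : Site 3 → ℝ := fun x => Real.sqrt (∑ j, ((x j : ℤ) : ℝ) ^ 2) with hnE
  set f : Site 3 → ℝ := fun x => MvPolynomial.eval (fun i => ((x i : ℤ) : ℝ)) Y *
    nE x ^ (2 * m) * twoPointFree 3 β x with hf
  have hfs : Summable f := summable_polyMoment hβ hβc Y hY m
  set F : Equiv.Perm (Fin 3) × (Fin 3 → ℤˣ) → Site 3 → ℝ := fun g x =>
    MvPolynomial.eval (fun i => ((g.2 i : ℤ) : ℝ) * ((x (g.1.symm i) : ℤ) : ℝ)) Y *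
      nE x ^ (2 * m) * twoPointFree 3 β x with hF
  have hpt : ∀ (g : Equiv.Perm (Fin 3) × (Fin 3 → ℤˣ)) (x : Site 3),
      f (Site.signedPerm g.1 g.2 x) = F g x := by
    intro g x
    have harg : (fun i => ((Site.signedPerm g.1 g.2 x i : ℤ) : ℝ)) =
        fun i => ((g.2 i : ℤ) : ℝ) * ((x (g.1.symm i) : ℤ) : ℝ) := by
      funext i
      rw [Site.signedPerm_apply, Int.cast_mul]
    simp only [hf, hF, hnE]
    rw [twoPointFree_signedPerm, euclid_signedPerm, harg]
  have hFs : ∀ g : Equiv.Perm (Fin 3) × (Fin 3 → ℤˣ), Summable (F g) := fun g =>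
    ((Equiv.summable_iff (Site.signedPerm g.1 g.2)).2 hfs).congr (hpt g)
  have hinv : ∀ g : Equiv.Perm (Fin 3) × (Fin 3 → ℤˣ), ∑' x, F g x = ∑' x, f x := by
    intro g
    calc ∑' x, F g x = ∑' x, f (Site.signedPerm g.1 g.2 x) := tsum_congr fun x => (hpt g x).symm
      _ = ∑' x, f x := Equiv.tsum_eq _ _
  have hexp : ∀ x : Site 3, MvPolynomial.eval (fun i => ((x i : ℤ) : ℝ))
        (∑ g : Equiv.Perm (Fin 3) × (Fin 3 → ℤˣ), MvPolynomial.aeval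
          (fun i => MvPolynomial.C ((g.2 i : ℤ) : ℝ) * MvPolynomial.X (g.1.symm i)) Y) *
        nE x ^ (2 * m) * twoPointFree 3 β x = ∑ g, F g x := by
    intro x
    rw [map_sum, Finset.sum_mul, Finset.sum_mul]
    refine Finset.sum_congr rfl fun g _ => ?_
    rw [eval_signedPermAct]
  rw [tsum_congr hexp, Summable.tsum_finsetSum (fun g _ => hFs g)]
  simp_rw [hinv]
  rw [Finset.sum_const, card_signedPerm_three, nsmul_eq_mul]
  norm_num

/-- **Reynolds reduction of the item.**  `HarmonicDilution` is equivalent to its restriction to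
the `B₃`-INVARIANT harmonic homogeneous polynomials of even degree `n ≥ 4` (the cubic harmonics
proper: `K₄` in degree 4, one line each in degrees 6, 8, 10, a plane in degree 12, …): for a
general harmonic `Y`, `k_{Y,m} = k_{R Y,m}/48` with `R Y = ∑_{g ∈ B₃} Y ∘ g` invariant, harmonic and
homogeneous of the same degree. -/
theorem harmonicDilution_iff_invariant :
    HarmonicDilution ↔
      ∀ (n m : ℕ) (Y : MvPolynomial (Fin 3) ℝ), 4 ≤ n → Even n → Y.IsHomogeneous n →
        (∑ i : Fin 3, MvPolynomial.pderiv i (MvPolynomial.pderiv i Y)) = 0 →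
        (∀ (π : Equiv.Perm (Fin 3)) (ε : Fin 3 → ℤˣ) (v : Fin 3 → ℝ),
          MvPolynomial.eval (fun i => ((ε i : ℤ) : ℝ) * v (π.symm i)) Y = MvPolynomial.eval v Y) →
        Tendsto (fun β => (∑' x : Site 3, MvPolynomial.eval (fun i => ((x i : ℤ) : ℝ)) Y *
              Real.sqrt (∑ i, ((x i : ℤ) : ℝ) ^ 2) ^ (2 * m) * twoPointFree 3 β x) /
            (∑' x : Site 3, Real.sqrt (∑ i, ((x i : ℤ) : ℝ) ^ 2) ^ (n + 2 * m) *
              twoPointFree 3 β x))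
          (𝓝[<] criticalBeta 3) (𝓝 0) := by
  rw [harmonicDilution_iff_even_four_le]
  constructor
  · intro h n m Y hn he hY hΔ _
    exact h n m Y hn he hY hΔ
  · intro h n m Y hn he hY hΔ
    have hβc : 0 < criticalBeta 3 := criticalBeta_pos_holds (by norm_num)
    set R : MvPolynomial (Fin 3) ℝ := ∑ g : Equiv.Perm (Fin 3) × (Fin 3 → ℤˣ),
      MvPolynomial.aeval (fun i => MvPolynomial.C ((g.2 i : ℤ) : ℝ) * MvPolynomial.X (g.1.symm i)) Y
      with hR
    have hRhom : R.IsHomogeneous n :=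
      MvPolynomial.IsHomogeneous.sum _ _ _ fun g _ => isHomogeneous_signedPermAct g.1 g.2 hY
    have hRΔ : ∑ i : Fin 3, MvPolynomial.pderiv i (MvPolynomial.pderiv i R) = 0 := by
      rw [hR]
      simp_rw [map_sum]
      rw [Finset.sum_comm]
      exact Finset.sum_eq_zero fun g _ => laplacian_signedPermAct g.1 g.2 hΔ
    have hRinv : ∀ (π : Equiv.Perm (Fin 3)) (ε : Fin 3 → ℤˣ) (v : Fin 3 → ℝ),
        MvPolynomial.eval (fun i => ((ε i : ℤ) : ℝ) * v (π.symm i)) R = MvPolynomial.eval v R :=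
      fun π ε v => eval_reynolds_signedPerm Y π ε v
    have hlim := (h n m R hn he hRhom hRΔ hRinv).const_mul (1 / 48)
    rw [mul_zero] at hlim
    refine hlim.congr' ?_
    filter_upwards [Ioo_mem_nhdsLT hβc] with β hβ
    rw [hR, harmonicMoment_reynolds hβ.1.le hβ.2 Y hY m]
    ring

end Summit.CriticalPhenomena.Ising3DConformalLimit.Theorems
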